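import Summits.ValiantsHypothesis.ValiantsHypothesis.Theorems.GrenetZeonDualUnipotentThreeHalvesSlowCoreLedger

/-!
# `GrenetZeon.DualUnipotentThreeHalves` (stmt-ValiantsHypothesis-24318), line `slow_core` — glue kernel II: FREEZING SPACES and the COARSENING (g5)/(g6)

Lemmas about the §8 definitions of ✓ `…SlowCoreLedger`: `linFun_apply`, `linEntry_eq_zero_of_mem_freezeSpace`, `codim_freezeSpace_le` (rank–nullity:
codim of a freezing space ≤ number of frozen positions), `codim_inf_le` / `codim_finset_inf_le` (codimensions add under ⊓); level book-keeping
`lvlCum_succ`, `lvlCum_mono`, `lvlCum_le`, `sum_lvlSize_eq`; the coarsening `coarsen lvl T` (threshold `T`): `coarsen_mono` (keeps the level cut),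
`coarsen_lt` (`< 2(m/T) + 2` merged classes), `eq_of_coarsen_eq_of_big` (a big level is alone in its merged class), ★ `card_small_class_lt` (the small-level
coordinates of one merged class number `< 2T` — window argument on cumulative sizes), `card_filter_prod_le` (row-bounded relations).
Honest framing.  Helpers (`--supports stmt-ValiantsHypothesis-24318`) consumed by `…SlowCoreGlue`; nothing here proves (c), S3, the crux 24318, 8062 or
`VP ≠ VNP` — all OPEN / NOT proved.  No definitions, no named facts.  (Inlined as PART A of `Cruxes/…/Lines/slow_core.lean` rev 3 @3b0d486a3202.)
-/

-- single-conjunct layout: Sub = Summit, duplicated namespace component intended (the name is mandated)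
set_option linter.dupNamespace false
set_option autoImplicit false

noncomputable section

namespace Summit.ValiantsHypothesis.ValiantsHypothesis.Theorems.GrenetZeon.SlowCore

open MvPolynomial Matrix
open scoped BigOperators
open Summit.ValiantsHypothesis.ValiantsHypothesis.Cruxes.TwoDimCoefficients.DimTwoCases (AffMat IsAffine)
open Summit.ValiantsHypothesis.ValiantsHypothesis.Theorems.GrenetZeon.RadicalSplit (lineSubst pencilAlg)

/-! ## §8 FREEZING SPACES: the joint kernel of the linear parts of a set of entries (codimension ≤ number of entries) -/

section FreezeSpace

variable {n m : ℕ}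

/-- `linFun` computes `linEntry`. -/
theorem linFun_apply (N : AffMat n m) (i j : Fin m) (v : Fin n × Fin n → ℂ) : linFun N i j v = linEntry N i j v := by
  simp only [linFun, linEntry, LinearMap.coe_sum, Finset.sum_apply, LinearMap.smul_apply, LinearMap.coe_proj,
    Function.eval, smul_eq_mul]
  exact Finset.sum_congr rfl fun c _ => mul_comm _ _

/-- The freezing space freezes `R`. -/
theorem linEntry_eq_zero_of_mem_freezeSpace (N : AffMat n m) (R : Finset (Fin m × Fin m)) {i j : Fin m} (hij : (i, j) ∈ R)
    {v : Fin n × Fin n → ℂ} (hv : v ∈ freezeSpace N R) : linEntry N i j v = 0 := by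
  rw [freezeSpace, LinearMap.mem_ker] at hv
  have h := congr_fun hv ⟨(i, j), hij⟩
  rw [LinearMap.pi_apply, linFun_apply] at h
  exact h

/-- **Codimension of a freezing space ≤ number of frozen positions** (rank–nullity). -/
theorem codim_freezeSpace_le (N : AffMat n m) (R : Finset (Fin m × Fin m)) :
    n * n - Module.finrank ℂ (freezeSpace N R) ≤ R.card := by
  have hrn := LinearMap.finrank_range_add_finrank_ker (LinearMap.pi fun r : R => linFun N r.1.1 r.1.2)
  have hdom : Module.finrank ℂ (Fin n × Fin n → ℂ) = n * n := by
    rw [Module.finrank_pi, Fintype.card_prod, Fintype.card_fin]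
  have hrange : Module.finrank ℂ (LinearMap.range (LinearMap.pi fun r : R => linFun N r.1.1 r.1.2)) ≤ R.card := by
    calc Module.finrank ℂ (LinearMap.range (LinearMap.pi fun r : R => linFun N r.1.1 r.1.2))
        ≤ Module.finrank ℂ (R → ℂ) := Submodule.finrank_le _
      _ = R.card := by rw [Module.finrank_pi, Fintype.card_coe]
  rw [hdom] at hrn
  rw [freezeSpace]
  omega

/-- Codimensions add under intersection (two spaces). -/
theorem codim_inf_le (A B : Submodule ℂ (Fin n × Fin n → ℂ)) :
    n * n - Module.finrank ℂ ↥(A ⊓ B) ≤ (n * n - Module.finrank ℂ A) + (n * n - Module.finrank ℂ B) := by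
  have h := Submodule.finrank_sup_add_finrank_inf_eq A B
  have hsup := finrank_dir_le n (A ⊔ B)
  have hA := finrank_dir_le n A
  have hB := finrank_dir_le n B
  omega

/-- Codimensions add under intersection (finite family). -/
theorem codim_finset_inf_le {ι : Type*} [DecidableEq ι] (s : Finset ι) (K : ι → Submodule ℂ (Fin n × Fin n → ℂ)) :
    n * n - Module.finrank ℂ ↥(s.inf K) ≤ ∑ t ∈ s, (n * n - Module.finrank ℂ (K t)) := by
  induction s using Finset.induction_on with
  | empty =>
    rw [Finset.inf_empty, Finset.sum_empty, finrank_top, Module.finrank_pi, Fintype.card_prod, Fintype.card_fin]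
    omega
  | insert a s ha ih =>
    rw [Finset.inf_insert, Finset.sum_insert ha]
    exact (codim_inf_le (K a) (s.inf K)).trans (by omega)

end FreezeSpace

/-! ## §9 LEVEL BOOK-KEEPING: sizes, cumulative sizes, and the COARSENING that merges runs of small levels (g6) -/

section Coarsen

variable {m : ℕ} (lvl : Fin m → ℕ)

/-- `cum (t+1) = cum t + size t`. -/
theorem lvlCum_succ (t : ℕ) : lvlCum lvl (t + 1) = lvlCum lvl t + lvlSize lvl t := by
  classical
  rw [lvlCum, lvlCum, lvlSize, ← Finset.card_union_of_disjoint]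
  · congr 1; ext i; simp only [Finset.mem_filter, Finset.mem_univ, true_and, Finset.mem_union]; omega
  · rw [Finset.disjoint_filter]; intro i _ h; omega

/-- Cumulative sizes are monotone. -/
theorem lvlCum_mono : Monotone (lvlCum lvl) := by
  intro t t' h
  exact Finset.card_le_card (fun i => by simp only [Finset.mem_filter, Finset.mem_univ, true_and]; omega)

/-- Cumulative sizes are `≤ m`. -/
theorem lvlCum_le (t : ℕ) : lvlCum lvl t ≤ m :=
  (Finset.card_le_univ _).trans (by rw [Fintype.card_fin])

/-- `cum t + size t ≤ cum t'` for `t < t'`. -/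
theorem lvlCum_add_size_le {t t' : ℕ} (h : t < t') : lvlCum lvl t + lvlSize lvl t ≤ lvlCum lvl t' := by
  rw [← lvlCum_succ]; exact lvlCum_mono lvl h

/-- Window arithmetic: `a + T ≤ b ⇒ ⌊a/T⌋ + 1 ≤ ⌊b/T⌋`. -/
theorem div_add_one_le_div {T a b : ℕ} (hT : 0 < T) (h : a + T ≤ b) : a / T + 1 ≤ b / T := by
  rw [← Nat.add_div_right a hT]
  exact Nat.div_le_div_right h

/-- The coarsening is monotone (so it keeps the level cut, `levelCut_mono`). -/
theorem coarsen_mono {T : ℕ} (hT : 0 < T) : Monotone (coarsen lvl T) := by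
  intro t t' h
  rcases eq_or_lt_of_le h with rfl | hlt
  · exact le_rfl
  simp only [coarsen]
  have hcum := lvlCum_add_size_le lvl hlt
  have hdiv : lvlCum lvl t / T ≤ lvlCum lvl t' / T := Nat.div_le_div_right (by omega)
  by_cases hb : T ≤ lvlSize lvl t
  · rw [if_pos hb]
    have h1 : lvlCum lvl t / T + 1 ≤ lvlCum lvl t' / T := div_add_one_le_div hT (by omega)
    split_ifs <;> omega
  · rw [if_neg hb]
    split_ifs <;> omega

/-- There are `< 2(m/T) + 2` merged classes. -/
theorem coarsen_lt (T t : ℕ) : coarsen lvl T t < 2 * (m / T) + 2 := by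
  simp only [coarsen]
  have h : lvlCum lvl t / T ≤ m / T := Nat.div_le_div_right (lvlCum_le lvl t)
  split_ifs <;> omega

/-- A BIG level shares its merged class with no other level. -/
theorem eq_of_coarsen_eq_of_big {T : ℕ} (hT : 0 < T) {t t' : ℕ} (hbig : T ≤ lvlSize lvl t)
    (h : coarsen lvl T t' = coarsen lvl T t) : t' = t := by
  by_contra hne
  have hbig' : T ≤ lvlSize lvl t' := by
    by_contra hs
    have h2 := h
    simp only [coarsen, if_pos hbig, if_neg hs] at h2
    omega
  -- both big: the later one is at least two classes further
  have key : ∀ {u u' : ℕ}, u < u' → T ≤ lvlSize lvl u → T ≤ lvlSize lvl u' → coarsen lvl T u + 2 ≤ coarsen lvl T u' := by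
    intro u u' huu hu hu'
    simp only [coarsen, if_pos hu, if_pos hu']
    have hcum := lvlCum_add_size_le lvl huu
    have h1 : lvlCum lvl u / T + 1 ≤ lvlCum lvl u' / T := div_add_one_le_div hT (by omega)
    omega
  rcases lt_or_gt_of_ne hne with hlt | hgt
  · have := key hlt hbig' hbig; omega
  · have := key hgt hbig hbig'; omega

/-- **WINDOW BOUND**: the coordinates in SMALL levels of one merged class number `< 2T`. -/
theorem card_small_class_lt {T : ℕ} (hT : 0 < T) (q : ℕ) :
    (Finset.univ.filter fun j : Fin m => lvlSize lvl (lvl j) < T ∧ coarsen lvl T (lvl j) = q).card < 2 * T := by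
  classical
  set J := Finset.univ.filter fun j : Fin m => lvlSize lvl (lvl j) < T ∧ coarsen lvl T (lvl j) = q with hJ
  rcases J.eq_empty_or_nonempty with hJe | hJne
  · rw [hJe, Finset.card_empty]; omega
  -- extreme levels occurring in J
  obtain ⟨jmax, hjmax, hmax⟩ := Finset.exists_max_image J lvl hJne
  obtain ⟨jmin, hjmin, hmin⟩ := Finset.exists_min_image J lvl hJne
  have hJmax := (Finset.mem_filter.1 hjmax).2
  have hJmin := (Finset.mem_filter.1 hjmin).2
  -- same window of cumulative size
  have hw : lvlCum lvl (lvl jmax) / T = lvlCum lvl (lvl jmin) / T := by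
    have h1 := hJmax.2; have h2 := hJmin.2
    simp only [coarsen, if_neg (not_le.2 hJmax.1), if_neg (not_le.2 hJmin.1)] at h1 h2
    omega
  have hwin : lvlCum lvl (lvl jmax) < lvlCum lvl (lvl jmin) + T := by
    have a1 : lvlCum lvl (lvl jmax) < (lvlCum lvl (lvl jmax) / T + 1) * T := Nat.lt_div_mul_add hT |>.trans_eq (by ring)
    have a2 : lvlCum lvl (lvl jmin) / T * T ≤ lvlCum lvl (lvl jmin) := Nat.div_mul_le_self _ _
    rw [hw] at a1
    nlinarith
  -- J sits between the two extreme levels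
  have hsub : J ⊆ (Finset.univ.filter fun i : Fin m => lvl i < lvl jmax + 1) \ (Finset.univ.filter fun i : Fin m => lvl i < lvl jmin) := by
    intro j hj
    simp only [Finset.mem_sdiff, Finset.mem_filter, Finset.mem_univ, true_and, not_lt]
    exact ⟨Nat.lt_succ_of_le (hmax j hj), hmin j hj⟩
  have hcard := Finset.card_le_card hsub
  rw [Finset.card_sdiff_of_subset (fun i => by simp only [Finset.mem_filter, Finset.mem_univ, true_and]; have := hmin jmax hjmax; omega)] at hcard
  change J.card ≤ lvlCum lvl (lvl jmax + 1) - lvlCum lvl (lvl jmin) at hcard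
  rw [lvlCum_succ] at hcard
  have hsmall := hJmax.1
  omega

/-- Total size: the levels below `L` exhaust the coordinates when every level is `< L`. -/
theorem sum_lvlSize_eq {L : ℕ} (hL : ∀ i, lvl i < L) : ∑ t ∈ Finset.range L, lvlSize lvl t = m := by
  have h : ∀ t, ∑ u ∈ Finset.range t, lvlSize lvl u = lvlCum lvl t := by
    intro t
    induction t with
    | zero => simp [lvlCum]
    | succ t ih => rw [Finset.sum_range_succ, ih, lvlCum_succ]
  rw [h, lvlCum]
  have : (Finset.univ.filter fun i : Fin m => lvl i < L) = Finset.univ := Finset.filter_true_of_mem fun i _ => hL i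
  rw [this, Finset.card_univ, Fintype.card_fin]

end Coarsen

/-- Pairs `(i, j)` with both coordinates in a fibrewise-bounded relation: `#R ≤ m · B` when every row of `R` has `≤ B` elements. -/
theorem card_filter_prod_le {m B : ℕ} (Prel : Fin m → Fin m → Prop) [DecidableRel Prel]
    (hrow : ∀ i, (Finset.univ.filter fun j => Prel i j).card ≤ B) :
    (Finset.univ.filter fun ij : Fin m × Fin m => Prel ij.1 ij.2).card ≤ m * B := by
  classical
  have heq : (Finset.univ.filter fun ij : Fin m × Fin m => Prel ij.1 ij.2) =
      Finset.univ.biUnion fun i : Fin m => (Finset.univ.filter fun j => Prel i j).map ⟨Prod.mk i, Prod.mk_right_injective i⟩ := by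
    ext ⟨i, j⟩
    simp only [Finset.mem_filter, Finset.mem_univ, true_and, Finset.mem_biUnion, Finset.mem_map, Function.Embedding.coeFn_mk,
      Prod.mk.injEq]
    constructor
    · intro h; exact ⟨i, j, h, rfl, rfl⟩
    · rintro ⟨i', j', h, rfl, rfl⟩; exact h
  rw [heq]
  refine (Finset.card_biUnion_le).trans ?_
  calc ∑ i : Fin m, ((Finset.univ.filter fun j => Prel i j).map ⟨Prod.mk i, Prod.mk_right_injective i⟩).card
      ≤ ∑ _i : Fin m, B := Finset.sum_le_sum fun i _ => by rw [Finset.card_map]; exact hrow i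
    _ = m * B := by rw [Finset.sum_const, Finset.card_univ, Fintype.card_fin, smul_eq_mul]

end Summit.ValiantsHypothesis.ValiantsHypothesis.Theorems.GrenetZeon.SlowCore
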